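import Summits.BirchSwinnertonDyer.Rank1Residual.Partition.CornersLargePrime
import Summits.BirchSwinnertonDyer.Rank1Residual.EisensteinPrimesSupport
import Literature.NumberTheory.EllipticCurves.Rank1Residual.EisensteinGoodComplement
import HarnessLib

/-!
# The strong partial theorem at LARGE primes with the prime `37` REMOVED from the exception set:
# at a good ordinary (resp. multiplicative, rank `0`) `p ≥ 11` the only excluded prime is `p = 13`
# (cell `b2b-bsdres`, RESIDUAL-MAP.md §A 'SPECIALISATION p ≥ 11' / 'EMPTY cells'; off-peak typer
# `lit-cgls`, session 9 — an elementary reduction of the Eisenstein column, kernel form of the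
# RESIDUAL-MAP sentence "the anomalous rows at 37 … EMPTY (prose + computation)")

HONEST FRAMING (run/shared/lean/b2b/bsd-rank1-residual/, verbatim in every file): the goal of the
cell is to DELETE the COMBINATION-SHAPED residual classes of the Birch–Swinnerton-Dyer formula for
ALL analytic-rank `≤ 1` elliptic curves over `ℚ` — "full BSD formula for every rank `≤ 1` curve in
class `C`" assembled STRICTLY from published theorems — so that the rank-`≤ 1` remainder becomes
exactly the CONSTRUCTION-SHAPED classes, which are TYPED (missing-input `Prop`s), NOT attempted.
This is not "finishing BSD". Research route; NO CLAIM BEYOND STATED CLASSES; nothing here changes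
a label; nothing is booked. THEOREMS ONLY (no definition, no named fact, no `sorry`); every
published theorem enters as one of the tree's existing named Literature facts BY NAME.

## What

`Partition/CornersLargePrime.lean` (rmap-1 gen 4) states the cell's STRONG PARTIAL THEOREM at a good
ORDINARY prime `p ≥ 11` (every `E/ℚ`, analytic rank `≤ 1`: `BSD(E,p)`, NO corner) and at a
MULTIPLICATIVE prime `p ≥ 11` in analytic rank `0` (`BSD(E,p)` unless '(ram) fails') under the
exceptions `p ≠ 13` AND `p ≠ 37`, because its only Eisenstein input is Greenberg, LNM 1716 p. 136
(`hGr136` = A163: a rational `p`-isogeny at a good ordinary or multiplicative `p` forces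
`p ∈ {2, 3, 5, 7, 13, 37}`). The exception `37` is spurious for the CORNERS: the two `X₀(37)` classes
(`j = -7·11³, -7·137³·2083³`, conductor `35²`; Mazur–Swinnerton-Dyer 1974, the `j`-table of
Cremona *Algorithms* §3.8 p. 82 = the tree's named fact `primeDegreeIsogeny_jTable`) have
`a₃₇ = ±8 ≢ 1 (mod 37)` on every twist with good reduction at `37` and are never multiplicative at
`37` — kernel theorems of sub-cell `eisenstein-p1` (`EisensteinPrimesSupport.lean`:
`EisensteinPrimes.not_anom_thirtySeven`, `not_mult_of_mem_jTable`, `mem_of_classX1`,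
`mem_of_classX2`: the classes X1 and X2 live at `p ∈ {3, 5, 7, 13}`). This file feeds those two
theorems into the large-prime headlines, so that the exception set of RESIDUAL-MAP §A's
'SPECIALISATION `p ≥ 11`' is `{13}` alone in the kernel:

* `not_classX1_of_eleven_le_of_ne_thirteen` / `not_classX2_of_eleven_le_of_ne_thirteen` — at
  `p ≥ 11`, `p ≠ 13`, no pair is in X1 (good ordinary `p`) resp. X2 (multiplicative `p`), granted
  `hGr136` (A163) and the `j`-table `hT`; primed variants from Mazur 1978 Thm. 1 (`hMaz` =
  `mazur_isogeny_irreducible`) and `hT` instead (eisenstein-p1's `mem_of_classX1` / `mem_of_classX2`).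
* `bsdp_goodOrd_of_eleven_le_of_ne_thirteen` — **every `E/ℚ` (CM or not) of analytic rank `≤ 1`,
  every good ORDINARY prime `p ≥ 11` with `p ≠ 13`: `BSD(E,p)`, NO corner** (the fourteen named
  facts of `Partition/Bsdp.lean` + BDMTV 2019 + A163 + the `j`-table; PUB\* flags travel with
  `hBCS` / `hJSW` / `hYZ` exactly as in `Corners.lean`); `…_sharp` — the same from the TWELVE facts
  actually used (BCS Cor. 1.3.1, GZK, BDMTV, Rubin ∧ Burungale–Flach, Kobayashi Cor. 1.4, modularity
  ×2, CGS Thm. D, GV Thm. (1.3), Greenberg Thm. 4.1, A163, `j`-table); `bsdp_goodOrd_thirtySeven` —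
  the instance `p = 37` (where the reducible pairs exist: `1225h`-twists, row C6).
* `bsdp_mult_rankZero_of_eleven_le_of_ne_thirteen` — **every `E/ℚ` of analytic rank `0`, every
  MULTIPLICATIVE prime `p ≥ 11` with `p ≠ 13`: `BSD(E,p)` unless '(ram) fails' (X11a)**;
  `…_of_ram_of_ne_thirteen` — with the (ram) witness stated positively (Skinner 2016 Thm C,
  modularity, GZK, A163, `j`-table).

At `p = 13` the corner is genuinely inhabited (`X₀(13)` has genus `0`: infinitely many `j` with a
rational `13`-isogeny, anomalous or multiplicative at `13` allowed), so `{13}` is the honest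
exception set of the large-prime form; the statements of `Corners.lean` stand there unchanged.

References: RESIDUAL-MAP.md §A (SPECIALISATION `p ≥ 11`, EMPTY cells), §C; HOME/PARTITION.md §3;
`Partition/Corners.lean`, `Partition/CornersLargePrime.lean` (rmap-1), `EisensteinPrimesSupport.lean`,
`X1/LeafPrimes.lean` (`bsdp_thirtySeven_of_good_red`, eisenstein-p1); Greenberg LNM 1716 §5 p. 136
[GreenbergLNM1716]; Mazur, Invent. Math. 44 (1978) Thm. 1, table p. 129 [Mazur1978];
Mazur–Swinnerton-Dyer, Invent. Math. 25 (1974) §5 [MazurSwinnertonDyer1974]; Cremona,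
*Algorithms* (1997) §3.8 p. 82 [CremonaAlgorithms1997]; HOME/b2b-bsdres-lit-cgls/CGLS-GV-TYPING.md §16.
-/

namespace Summit.BirchSwinnertonDyer.Rank1Residual

open WeierstrassCurve Literature.NumberTheory.EllipticCurves
  Literature.NumberTheory.EllipticCurves.Rank1Residual Literature.NumberTheory.EllipticCurves.ModularForms
  Literature.NumberTheory.EllipticCurves.Greenberg1999
open scoped NumberField

section Curve

variable {W : WeierstrassCurve ℚ} [W.IsElliptic] [W.IsGloballyMinimal] {p : ℕ} [Fact p.Prime]

/-! ### No Eisenstein corner at `p ≥ 11`, `p ≠ 13` -/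

/-- **No X1 corner at a good ordinary `p ≥ 11` other than `13`** (granted Greenberg LNM 1716 p. 136
`hGr136` and the `j`-table `hT`): by `hGr136` a reducible `E[p]` at a good ordinary `p ≥ 11` needs
`p ∈ {13, 37}`, and at `p = 37` no curve is anomalous (`EisensteinPrimes.not_anom_thirtySeven`:
`a₃₇ = ±8` on the two `X₀(37)` classes). [cite: GreenbergLNM1716, §5 p. 136]
[cite: MazurSwinnertonDyer1974, §5] [cite: CremonaAlgorithms1997, §3.8 p. 82] -/
theorem not_classX1_of_eleven_le_of_ne_thirteen (hGr136 : p136_mem_isogenyPrimes_of_reducible)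
    (hT : primeDegreeIsogeny_jTable) (hgo : GoodOrd W p) (h11 : 11 ≤ p) (h13 : p ≠ 13) :
    ¬ ClassX1 W p := by
  intro hX1
  obtain ⟨-, hred, -, hanom, -⟩ := hX1
  rcases p136_mem_isogenyPrimes_of_reducible.eq_thirteen_or_eq_thirtySeven hGr136 (Or.inl hgo) hred
      h11 with h | h
  · exact h13 h
  · subst h
    exact EisensteinPrimes.not_anom_thirtySeven hT W hanom

/-- **No X2 corner at a multiplicative `p ≥ 11` other than `13`** (granted `hGr136` and `hT`): by
`hGr136` a reducible `E[p]` at a multiplicative `p ≥ 11` needs `p ∈ {13, 37}`, and no curve with a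
rational `37`-isogeny is multiplicative at `37` (`ord₃₇ j ≥ 0` on the `j`-table:
`EisensteinPrimes.not_mult_of_mem_jTable`). [cite: GreenbergLNM1716, §5 p. 136]
[cite: CremonaAlgorithms1997, §3.8 p. 82] [cite: Mazur1978, Cor. 4.4 and table p. 129] -/
theorem not_classX2_of_eleven_le_of_ne_thirteen (hGr136 : p136_mem_isogenyPrimes_of_reducible)
    (hT : primeDegreeIsogeny_jTable) (hm : Mult W p) (h11 : 11 ≤ p) (h13 : p ≠ 13) :
    ¬ ClassX2 W p := by
  intro hX2
  obtain ⟨-, hred, -⟩ := hX2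
  rcases p136_mem_isogenyPrimes_of_reducible.eq_thirteen_or_eq_thirtySeven hGr136 (Or.inr hm) hred
      h11 with h | h
  · exact h13 h
  · subst h
    exact EisensteinPrimes.not_mult_of_mem_jTable (W := W)
      (EisensteinPrimes.mem_jTable_of_red hT W 37 (by decide) hred) hm

/-- The same exclusion of X1 from Mazur 1978 Thm. 1 (`hMaz`) and the `j`-table (`hT`) instead of
A163: eisenstein-p1's `EisensteinPrimes.mem_of_classX1` (`ClassX1 W p → p ∈ {3, 5, 7, 13}`).
[cite: Mazur1978, Thm. 1 and table p. 129] [cite: CremonaAlgorithms1997, §3.8 p. 82] -/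
theorem not_classX1_of_eleven_le_of_ne_thirteen' (hMaz : mazur_isogeny_irreducible)
    (hT : primeDegreeIsogeny_jTable) (h11 : 11 ≤ p) (h13 : p ≠ 13) : ¬ ClassX1 W p := by
  intro hX1
  have hm := EisensteinPrimes.mem_of_classX1 hMaz hT W p hX1
  simp only [Finset.mem_insert, Finset.mem_singleton] at hm
  omega

omit [W.IsGloballyMinimal] in
/-- The same exclusion of X2 from `hMaz` and `hT` (eisenstein-p1's `EisensteinPrimes.mem_of_classX2`:
`ClassX2 W p → p ∈ {3, 5, 7, 13}`). [cite: Mazur1978, Thm. 1, Cor. 4.4 and table p. 129]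
[cite: CremonaAlgorithms1997, §3.8 p. 82] -/
theorem not_classX2_of_eleven_le_of_ne_thirteen' (hMaz : mazur_isogeny_irreducible)
    (hT : primeDegreeIsogeny_jTable) (h11 : 11 ≤ p) (h13 : p ≠ 13) : ¬ ClassX2 W p := by
  intro hX2
  have hm := EisensteinPrimes.mem_of_classX2 hMaz hT W p hX2
  simp only [Finset.mem_insert, Finset.mem_singleton] at hm
  omega

/-- **`E[p]` irreducible at a multiplicative `p ≥ 11`, `p ≠ 13`** (granted `hGr136` and `hT`): the
`j`-table excludes multiplicative reduction at `37`. [cite: GreenbergLNM1716, §5 p. 136]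
[cite: CremonaAlgorithms1997, §3.8 p. 82] -/
theorem irr_of_mult_of_eleven_le_of_ne_thirteen (hGr136 : p136_mem_isogenyPrimes_of_reducible)
    (hT : primeDegreeIsogeny_jTable) (hm : Mult W p) (h11 : 11 ≤ p) (h13 : p ≠ 13) : Irr W p := by
  by_contra hred
  have hp2 : p ≠ 2 := by omega
  exact not_classX2_of_eleven_le_of_ne_thirteen hGr136 hT hm h11 h13 ⟨hp2, hred, hm⟩

/-! ### The strong partial theorem, large good ORDINARY primes: the exception set is `{13}` -/

/-- **STRONG PARTIAL THEOREM, large good ORDINARY primes — NO CORNER, `p ≠ 13` ONLY.** Granted the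
fourteen named published facts of the covered rows, BDMTV 2019 Thm 1.2, Greenberg LNM 1716 p. 136
(A163) and the `j`-table of the rational isogenies of prime degree (Cremona §3.8 p. 82 /
Mazur–Swinnerton-Dyer 1974): for EVERY `E/ℚ` (globally minimal `W`, CM or not) of analytic rank
`≤ 1` and EVERY good ordinary prime `p ≥ 11` with `p ≠ 13`, Miller's `BSD(E,p)` holds. (PUB\* flags
travel with `hBCS` / `hJSW` / `hYZ` as in `Corners.lean`; at `p = 37` the reducible pairs — the
`1225h`-twists — are row C6, Castella–Grossi–Skinner 2025 Thm. D.) Proof: X1 is empty here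
(`not_classX1_of_eleven_le_of_ne_thirteen`), then `Corners.bsdp_goodOrd_of_eleven_le'`.
[cite: GreenbergLNM1716, §5 p. 136] [cite: MazurSwinnertonDyer1974, §5]
[cite: CastellaGrossiSkinner2025, Theorem D] -/
theorem bsdp_goodOrd_of_eleven_le_of_ne_thirteen (hSk : Skinner2016.thmC_padicValRat_bsd_rank_zero)
    (hBCS : BurungaleCastellaSkinner2025.cor131_padicValRat_bsd_rank_le_one)
    (hJSW : JetchevSkinnerWan2017.thm121_padicValRat_bsd_rank_one)
    (hCGS : CastellaGrossiSkinner2025.thmD_padicValRat_bsd_rank_le_one)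
    (hGV : GreenbergVatsal2000.thm13_charIdeal_eq_of_gvPar) (hGr : greenberg_charValue_rankZero)
    (hmod : hasEntireLFunction_rat) (hmodP : nonempty_modularParametrizationData)
    (hGZK : rank_eq_analyticRank_of_analyticRank_le_one)
    (hCM : bsdTriple_of_hasCM_of_L_one_ne_zero) (hKob : Kobayashi2013.cor14_bsdp_of_cm_rank_one)
    (hYZ : YanZhu2026.thm415_padicValRat_bsd_rank_le_one)
    (hW20 : Wuthrich2014.lemma20_surjective_threeAdic_of_semistable)
    (hLLT : LiLiuTian2024.thm11_bsdp_of_cm_rank_one)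
    (hBDMTV : BalakrishnanEtAl2019.thm12_not_le_normalizer_splitCartan)
    (hGr136 : p136_mem_isogenyPrimes_of_reducible) (hT : primeDegreeIsogeny_jTable)
    (hr : W.analyticRank ≤ 1) (hgo : GoodOrd W p) (h11 : 11 ≤ p) (h13 : p ≠ 13) : BSDp W p :=
  bsdp_goodOrd_of_eleven_le' hSk hBCS hJSW hCGS hGV hGr hmod hmodP hGZK hCM hKob hYZ hW20 hLLT hBDMTV
    hr hgo h11 (not_classX1_of_eleven_le_of_ne_thirteen hGr136 hT hgo h11 h13)

/-- **SHARP, every curve, `p ≠ 13`: TWELVE named facts.** For EVERY `E/ℚ` of analytic rank `≤ 1`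
and EVERY good ordinary prime `p ≥ 11` with `p ≠ 13`, `BSD(E,p)` follows from: BCS 2025 Cor. 1.3.1
(`hBCS`, PUB\*), GZK, BDMTV 2019, Rubin 1991 ∧ Burungale–Flach 2024 (`hCM`), Kobayashi 2013
Cor. 1.4 (`hKob`), modularity (`hmod`, `hmodP`) — the irreducible branch,
`bsdp_goodOrd_of_irr_of_eleven_le_allCurves_sharp` — and, on the REDUCIBLE branch (which by A163
`hGr136` lives at `p = 37` only and is never anomalous by the `j`-table `hT`), Castella–Grossi–
Skinner 2025 Thm. D (`hCGS`), Greenberg–Vatsal 2000 Thm. (1.3) (`hGV`), Greenberg 1999 Thm. 4.1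
(`hGr`) through x1a's `Rank1Residual.bsdp_of_not_classX1`. No `hSk`, `hJSW`, `hYZ`, `hW20`, `hLLT`.
[cite: CastellaGrossiSkinner2025, Theorem D] [cite: GreenbergVatsal2000, Thm. (1.3)]
[cite: GreenbergLNM1716, Thm. 4.1 and §5 p. 136] [cite: MazurSwinnertonDyer1974, §5] -/
theorem bsdp_goodOrd_of_eleven_le_of_ne_thirteen_sharp
    (hBCS : BurungaleCastellaSkinner2025.cor131_padicValRat_bsd_rank_le_one)
    (hGZK : rank_eq_analyticRank_of_analyticRank_le_one)
    (hBDMTV : BalakrishnanEtAl2019.thm12_not_le_normalizer_splitCartan)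
    (hCM : bsdTriple_of_hasCM_of_L_one_ne_zero) (hKob : Kobayashi2013.cor14_bsdp_of_cm_rank_one)
    (hmod : hasEntireLFunction_rat) (hmodP : nonempty_modularParametrizationData)
    (hCGS : CastellaGrossiSkinner2025.thmD_padicValRat_bsd_rank_le_one)
    (hGV : GreenbergVatsal2000.thm13_charIdeal_eq_of_gvPar) (hGr : greenberg_charValue_rankZero)
    (hGr136 : p136_mem_isogenyPrimes_of_reducible) (hT : primeDegreeIsogeny_jTable)
    (hr : W.analyticRank ≤ 1) (hgo : GoodOrd W p) (h11 : 11 ≤ p) (h13 : p ≠ 13) : BSDp W p := by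
  by_cases hirr : Irr W p
  · exact bsdp_goodOrd_of_irr_of_eleven_le_allCurves_sharp hBCS hGZK hBDMTV hCM hKob hmod hr hgo h11
      hirr
  · exact Rank1Residual.bsdp_of_not_classX1 hCGS hGV hGr hmod hmodP hGZK W p (by omega) hgo.1 hirr hr
      (not_classX1_of_eleven_le_of_ne_thirteen hGr136 hT hgo h11 h13)

/-- **The instance `p = 37`: every `E/ℚ` of analytic rank `≤ 1` with good ordinary reduction at
`37` satisfies `BSD(E,37)`** (twelve facts; the reducible pairs here are the `1225h`-twists, row C6 —
eisenstein-p1's `X1.RankZero.bsdp_thirtySeven_of_good_red` is the reducible half).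
[cite: CastellaGrossiSkinner2025, Theorem D] [cite: MazurSwinnertonDyer1974, §5] -/
theorem bsdp_goodOrd_thirtySeven
    (hBCS : BurungaleCastellaSkinner2025.cor131_padicValRat_bsd_rank_le_one)
    (hGZK : rank_eq_analyticRank_of_analyticRank_le_one)
    (hBDMTV : BalakrishnanEtAl2019.thm12_not_le_normalizer_splitCartan)
    (hCM : bsdTriple_of_hasCM_of_L_one_ne_zero) (hKob : Kobayashi2013.cor14_bsdp_of_cm_rank_one)
    (hmod : hasEntireLFunction_rat) (hmodP : nonempty_modularParametrizationData)
    (hCGS : CastellaGrossiSkinner2025.thmD_padicValRat_bsd_rank_le_one)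
    (hGV : GreenbergVatsal2000.thm13_charIdeal_eq_of_gvPar) (hGr : greenberg_charValue_rankZero)
    (hGr136 : p136_mem_isogenyPrimes_of_reducible) (hT : primeDegreeIsogeny_jTable)
    {W : WeierstrassCurve ℚ} [W.IsElliptic] [W.IsGloballyMinimal] [Fact (Nat.Prime 37)]
    (hr : W.analyticRank ≤ 1) (hgo : GoodOrd W 37) : BSDp W 37 :=
  bsdp_goodOrd_of_eleven_le_of_ne_thirteen_sharp hBCS hGZK hBDMTV hCM hKob hmod hmodP hCGS hGV hGr
    hGr136 hT hr hgo (by norm_num) (by norm_num)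

/-! ### The strong partial theorem, large MULTIPLICATIVE primes, rank `0`: exception set `{13}` -/

/-- **STRONG PARTIAL THEOREM, large MULTIPLICATIVE primes, rank `0` — the only corner is '(ram)
fails', `p ≠ 13` ONLY.** Granted Skinner 2016 Thm C, modularity, GZK, A163 and the `j`-table: for
every `E/ℚ` of analytic rank `0` and every multiplicative prime `p ≥ 11` with `p ≠ 13`, `BSD(E,p)`
holds unless `(E, p)` is in X11a (no multiplicative `q ≠ p` with `E[p]` ramified at `q`). The
Eisenstein corner X2 is empty here (`not_classX2_of_eleven_le_of_ne_thirteen`).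
[cite: Skinner2016PacificMC, Thm. C] [cite: GreenbergLNM1716, §5 p. 136] [cite: CremonaAlgorithms1997, §3.8 p. 82] -/
theorem bsdp_mult_rankZero_of_eleven_le_of_ne_thirteen
    (hSk : Skinner2016.thmC_padicValRat_bsd_rank_zero)
    (hmod : hasEntireLFunction_rat) (hGZK : rank_eq_analyticRank_of_analyticRank_le_one)
    (hGr136 : p136_mem_isogenyPrimes_of_reducible) (hT : primeDegreeIsogeny_jTable)
    (hm : Mult W p) (hr0 : W.analyticRank = 0) (h11 : 11 ≤ p) (h13 : p ≠ 13)
    (hX11a : ¬ ClassX11a W p) : BSDp W p :=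
  bsdp_mult_rankZero_of_not_corner hSk hmod hGZK (by omega) hm hr0 hX11a
    (not_classX2_of_eleven_le_of_ne_thirteen hGr136 hT hm h11 h13)

/-- The same with the (ram) witness stated positively: at a multiplicative `p ≥ 11`, `p ≠ 13`, in
analytic rank `0`, a second multiplicative prime `q` with `p ∤ v_q(Δ_min)` gives `BSD(E,p)`
(Skinner 2016 Thm C; irreducibility automatic by `irr_of_mult_of_eleven_le_of_ne_thirteen`).
[cite: Skinner2016PacificMC, Thm. C] [cite: GreenbergLNM1716, §5 p. 136] [cite: CremonaAlgorithms1997, §3.8 p. 82] -/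
theorem bsdp_mult_rankZero_of_eleven_le_of_ram_of_ne_thirteen
    (hSk : Skinner2016.thmC_padicValRat_bsd_rank_zero)
    (hmod : hasEntireLFunction_rat) (hGZK : rank_eq_analyticRank_of_analyticRank_le_one)
    (hGr136 : p136_mem_isogenyPrimes_of_reducible) (hT : primeDegreeIsogeny_jTable)
    (hm : Mult W p) (hr0 : W.analyticRank = 0) (h11 : 11 ≤ p) (h13 : p ≠ 13) (hram : Ram W p) :
    BSDp W p :=
  bsdp_mult_rankZero_of_irr_of_ram hSk hmod hGZK (by omega) hm hr0
    (irr_of_mult_of_eleven_le_of_ne_thirteen hGr136 hT hm h11 h13) hram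

end Curve

end Summit.BirchSwinnertonDyer.Rank1Residual
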